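import Literature.Barriers.CriticalPhenomena.LaceExpansionHighDimensionLowerHalf
import Literature.Probability.Percolation.BKFinitary
import Literature.Probability.Percolation.ClusterBoundary
import Literature.Probability.Percolation.PlanarDuality
import Literature.Probability.Percolation.SharpnessDCTProofs
import HarnessLib

/-!
# The critical one-arm probability of `ℤ^d` is at least `c n^{-(d-1)/2}` (BK + `φ_{p_c} ≥ 1`)

Topic `Literature/Probability/Percolation`. The classical "two-arm count" lower bound on the one-arm
probability `π_p(n) = P_p(0 ↔ ∂Λ_n)` of nearest-neighbour bond percolation on `ℤ^d`, `d ≥ 2`, at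
(and above) criticality:

  `π_{p_c}(n)² ≥ c_d / n^{d-1}`, i.e. `π_{p_c}(n) ≥ √c_d · n^{-(d-1)/2}` for all `n ≥ 1`.

It sharpens the input-free bound `π_{p_c}(n) ≥ c/n^{d-1}` of
`Literature.Barriers.CriticalPhenomena.exists_oneArmProb_criticalProbI_lower`
(`LaceExpansionHighDimensionLowerHalf.lean`) by a square root — on `ℤ³` from `c/n²` to `c/n`, on `ℤ²`
from `c/n` to `c/√n` — and is the generic-dimension form of the bound every scaling discussion quotes
(`x₁ ≤ (d-1)/2`; mean-field `x₁ = 2` is compatible exactly when `d ≥ 5`).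

Proof (folklore; the standard first application of the van den Berg–Kesten inequality, combined with
Hammersley / Simon–Lieb / Duminil-Copin–Tassion's `φ_{p_c}(Λ_n) ≥ 1`):
* `sum_sphere_real_openConnIn_ge` (tree, Kozma–Nachmias 2011 Lemma 3.1 via `φ_{p_c} ≥ 1`):
  `Σ_{z ∈ ∂Λ_n} P_{p_c}(0 ↔ z in Λ_n) ≥ 1/(2d)`;
* `real_openConnIn_box_le_oneArmProb_sq` (here): for `z ∈ ∂Λ_n` and `k = ⌊(n-1)/2⌋`, an open path from
  `0` to `z` contains an arm from `0` to `∂Λ_k` inside `Λ_k` (first exit) and an arm from `z` to `z + ∂Λ_k`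
  inside `z + Λ_k` (first exit of the reversed path); the two boxes are disjoint (`2k < n = ‖z‖_∞`), so the
  arms are edge-disjoint and BK (`bk_finitary`) gives `P_p(0 ↔ z in Λ_n) ≤ π_p(k)²`, every `p`;
* hence `1/(2d) ≤ |∂Λ_{2k+1}| · π_{p_c}(k)²` and `|∂Λ_{2k+1}| ≤ 2d·3^{d-1}(2k+1)^{d-1} ≤ 2d·9^{d-1} k^{d-1}`.

## References (informal; the statement is tagged folklore)

* J. van den Berg, H. Kesten, J. Appl. Probab. 22 (1985) 556–569, §3 (applications of the BK inequality).
* G. Kozma, A. Nachmias, J. Amer. Math. Soc. 24 (2011), §1 (the easy bounds on `P(0 ↔ ∂Q_r)`), Lemma 3.1.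
* G. Grimmett, Percolation (1999), Thm. (2.12)/(2.15) (BK), §5.2/§6.
-/

noncomputable section

namespace Literature.Probability.Percolation

open _root_.MeasureTheory _root_.Finset Literature.Probability.LatticeModels
  Literature.Probability.Percolation.DCT16 Literature.Barriers.CriticalPhenomena
open scoped Literature.Probability.Percolation

variable {d : ℕ}

/-! ### Walks: first exit with edge bookkeeping -/

/-- **First exit of a walk, with edges.** A walk from a vertex of `B` to a vertex outside `B` has a
first exit edge `a ∼ b` (`a ∈ B`, `b ∉ B`) preceded by an initial segment `q` lying in `B`, whose edges
are edges of the walk. [folklore] -/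
theorem exists_firstExit_edges {V : Type*} {G : SimpleGraph V} (B : Set V) :
    ∀ {u w : V} (p : G.Walk u w), u ∈ B → w ∉ B →
      ∃ (a b : V) (q : G.Walk u a), G.Adj a b ∧ a ∈ B ∧ b ∉ B ∧ (∀ z ∈ q.support, z ∈ B) ∧
        ∀ e ∈ q.edges, e ∈ p.edges
  | _, _, SimpleGraph.Walk.nil, hu, hw => absurd hu hw
  | u, _, SimpleGraph.Walk.cons (v := v') h p', hu, hw => by
      by_cases hv' : v' ∈ B
      · obtain ⟨a, b, q, hab, ha, hb, hq, hqe⟩ := exists_firstExit_edges B p' hv' hw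
        refine ⟨a, b, SimpleGraph.Walk.cons h q, hab, ha, hb, ?_, ?_⟩
        · intro z hz
          rw [SimpleGraph.Walk.support_cons, List.mem_cons] at hz
          rcases hz with rfl | hz
          · exact hu
          · exact hq z hz
        · intro e he
          rw [SimpleGraph.Walk.edges_cons, List.mem_cons] at he ⊢
          rcases he with rfl | he
          · exact Or.inl rfl
          · exact Or.inr (hqe e he)
      · exact ⟨u, v', SimpleGraph.Walk.nil, h, hu, hv', by simp [hu], by simp⟩

/-! ### The arm events are finitary and increasing -/

/-- `{0 ↔ ∂Λ_n}` is finitary (an open path has finitely many edges). [folklore] -/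
theorem isFinitary_siteToBoundary (d n : ℕ) : IsFinitary (siteToBoundary d n) := by
  classical
  rintro ω ⟨y, hy, hω⟩
  obtain ⟨K, hKω, hK⟩ := isFinitary_openConnIn _ _ _ ω hω
  exact ⟨K, hKω, y, hy, hK⟩

/-- The translated arm event `{v ↔ v + ∂Λ_n in v + Λ_n}` is increasing. [folklore] -/
theorem isUpperSet_armEvent_translate (v : Site d) (n : ℕ) : IsUpperSet (DCT16.armEvent v n) := by
  rintro ω ω' hle ⟨a, ha, hω⟩
  exact ⟨a, ha, isUpperSet_openConnIn _ _ _ hle hω⟩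

/-- The translated arm event `{v ↔ v + ∂Λ_n in v + Λ_n}` is finitary. [folklore] -/
theorem isFinitary_armEvent_translate (v : Site d) (n : ℕ) : IsFinitary (DCT16.armEvent v n) := by
  classical
  rintro ω ⟨a, ha, hω⟩
  obtain ⟨K, hKω, hK⟩ := isFinitary_openConnIn _ _ _ ω hω
  exact ⟨K, hKω, a, ha, hK⟩

/-! ### Two disjoint arms out of one connection -/

/-- Geometry: for `‖z‖_∞ = n` and `2k < n`, the boxes `Λ_k` and `z + Λ_k` are disjoint. [folklore] -/
theorem not_mem_box_of_sub_mem_box {n k : ℕ} (hk : 2 * k < n) {z w : Site d} (hz : z ∈ sphere d n)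
    (hw : w ∈ box d k) : w - z ∉ box d k := by
  intro hwz
  rw [mem_sphere] at hz
  have hd : (Finset.univ : Finset (Fin d)).Nonempty := by
    rw [Finset.univ_nonempty_iff]
    by_contra h'
    rw [not_nonempty_iff] at h'
    have : Site.supNorm z = 0 := by simp [Site.supNorm, Finset.univ_eq_empty]
    omega
  obtain ⟨i, hi⟩ := Site.exists_natAbs_eq_supNorm hd z
  have h1 := (mem_box.1 hw) i
  have h2 := (mem_box.1 hwz) i
  simp only [Pi.sub_apply] at h2
  omega

/-- **One connection, two disjoint arms** (lattice configurations). If `ω ⊆ E(ℤ^d)` joins `0` to a site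
`z` with `‖z‖_∞ = n` inside some set, and `2k < n`, then the arm events `{0 ↔ ∂Λ_k in Λ_k}` and
`{z ↔ z + ∂Λ_k in z + Λ_k}` occur DISJOINTLY: cut an open lattice walk from `0` to `z` at its first exit
from `Λ_k`, and the reversed walk at its first exit from `z + Λ_k`; the two initial segments live in the
disjoint boxes `Λ_k`, `z + Λ_k`, so they share no edge. [folklore] -/
theorem mem_disjointOccurrence_arms_of_openConnIn {n k : ℕ} (hk : 2 * k < n) {ω : BondConfig (Site d)}
    (hω : ω ⊆ (zdGraph d).edgeSet) {S : Set (Site d)} {z : Site d} (hz : z ∈ sphere d n)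
    (h : ω ∈ openConnIn S 0 z) :
    ω ∈ siteToBoundary d k □ DCT16.armEvent z k := by
  classical
  obtain ⟨p, -, hpω⟩ := exists_walk_of_mem_openConnIn hω h
  -- first exit of `p` from `Λ_k`
  have h0 : (0 : Site d) ∈ (↑(box d k) : Set (Site d)) := Finset.mem_coe.2 (zero_mem_box d k)
  have hzk : z ∉ (↑(box d k) : Set (Site d)) := fun hz' => by
    have h' := not_mem_box_of_sub_mem_box hk hz (Finset.mem_coe.1 hz')
    rw [sub_self] at h'
    exact h' (zero_mem_box d k)
  obtain ⟨a, b, q, hab, ha, hb, hq, hqe⟩ := exists_firstExit_edges (↑(box d k) : Set (Site d)) p h0 hzk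
  -- first exit of `p.reverse` from `z + Λ_k`
  set Bz : Set (Site d) := {w | w - z ∈ box d k} with hBz
  have hzBz : z ∈ Bz := by
    show z - z ∈ box d k
    rw [sub_self]
    exact zero_mem_box d k
  have h0Bz : (0 : Site d) ∉ Bz := fun h0' => by
    have h1 : (0 : Site d) - z ∈ box d k := h0'
    have := not_mem_box_of_sub_mem_box hk hz (zero_mem_box d k)
    exact this h1
  obtain ⟨a', b', q', hab', ha', hb', hq', hqe'⟩ := exists_firstExit_edges Bz p.reverse hzBz h0Bz
  -- the two witnesses
  set K : Set (Sym2 (Site d)) := {e | e ∈ q.edges} with hK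
  set L : Set (Sym2 (Site d)) := {e | e ∈ q'.edges} with hL
  have hKω : K ⊆ ω := fun e he => hpω e (hqe e he)
  have hLω : L ⊆ ω := fun e he => hpω e (by
    have := hqe' e he
    rwa [SimpleGraph.Walk.edges_reverse, List.mem_reverse] at this)
  have hdisj : Disjoint K L := by
    rw [Set.disjoint_left]
    intro e heK heL
    induction e using Sym2.ind with
    | h s t =>
      have hs1 : s ∈ box d k := Finset.mem_coe.1 (hq s (q.fst_mem_support_of_mem_edges heK))
      have hs2 : s - z ∈ box d k := hq' s (q'.fst_mem_support_of_mem_edges heL)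
      exact not_mem_box_of_sub_mem_box hk hz hs1 hs2
  have hKA : K ∈ siteToBoundary d k := by
    refine ⟨a, mem_innerBoundary_iff.2 ⟨Finset.mem_coe.1 ha, b, fun h' => hb (Finset.mem_coe.2 h'), hab⟩,
      mem_openConnIn_of_walk q hq fun e he => he⟩
  have hLB : L ∈ DCT16.armEvent z k := by
    refine ⟨a', mem_innerBoundary_iff.2 ⟨ha', b' - z, hb', ?_⟩, mem_openConnIn_of_walk q' hq' fun e he => he⟩
    rw [zdGraph_adj_sub_iff]
    exact hab'
  exact ((isUpperSet_siteToBoundary d k).mem_disjointOccurrence_iff (isUpperSet_armEvent_translate z k) ω).2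
    ⟨K, hKω, L, hLω, hdisj, hKA, hLB⟩

/-- **`P_p(0 ↔ z in Λ_n) ≤ π_p(k)²`** for `‖z‖_∞ = n`, `2k < n`, every `p` (BK on the two disjoint arms of
`mem_disjointOccurrence_arms_of_openConnIn`; translation invariance `DCT16.real_armEvent`). [folklore] -/
theorem real_openConnIn_box_le_oneArmProb_sq (p : unitInterval) {n k : ℕ} (hk : 2 * k < n) {z : Site d}
    (hz : z ∈ sphere d n) :
    (bondPercolation (zdGraph d) p).real (openConnIn (↑(box d n) : Set (Site d)) 0 z) ≤
      oneArmProb d p k ^ 2 := by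
  classical
  calc (bondPercolation (zdGraph d) p).real (openConnIn (↑(box d n) : Set (Site d)) 0 z)
      ≤ (bondPercolation (zdGraph d) p).real (siteToBoundary d k □ DCT16.armEvent z k) :=
        real_mono_of_forall_subset_edgeSet (zdGraph d) p fun ω hω h =>
          mem_disjointOccurrence_arms_of_openConnIn hk hω hz h
    _ ≤ (bondPercolation (zdGraph d) p).real (siteToBoundary d k) *
          (bondPercolation (zdGraph d) p).real (DCT16.armEvent z k) :=
        bk_finitary (zdGraph d) p (isUpperSet_siteToBoundary d k) (isUpperSet_armEvent_translate z k)
          (isFinitary_siteToBoundary d k) (isFinitary_armEvent_translate z k)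
    _ = oneArmProb d p k ^ 2 := by rw [DCT16.real_armEvent, sq]; rfl

/-! ### The critical bound -/

/-- **`1/(2d) ≤ |∂Λ_{2k+1}| · π_{p_c}(k)²`** on `ℤ^d`, `d ≥ 2`: Kozma–Nachmias's Lemma 3.1
(`sum_sphere_real_openConnIn_ge`, from `φ_{p_c} ≥ 1`) on the box `Λ_{2k+1}`, each summand bounded by
`real_openConnIn_box_le_oneArmProb_sq`. [folklore] -/
theorem one_div_le_card_sphere_mul_oneArmProb_sq (hd : 2 ≤ d) (k : ℕ) :
    1 / (2 * d) ≤ #(sphere d (2 * k + 1)) * oneArmProb d (criticalProbI d) k ^ 2 := by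
  have hsum := sum_sphere_real_openConnIn_ge hd (criticalProbI d) le_rfl (2 * k + 1)
  refine hsum.trans ?_
  rw [← nsmul_eq_mul, ← Finset.sum_const]
  exact Finset.sum_le_sum fun z hz => real_openConnIn_box_le_oneArmProb_sq _ (by omega) hz

/-- **THE CRITICAL ONE-ARM PROBABILITY IS AT LEAST `c n^{-(d-1)/2}` — squared form**: on `ℤ^d`, `d ≥ 2`,
there is `c = c(d) > 0` with `c / n^{d-1} ≤ π_{p_c}(n)²` for all `n ≥ 1`. The classical two-arm count
(BK + `φ_{p_c} ≥ 1`); it improves `exists_oneArmProb_criticalProbI_lower` (`c/n^{d-1} ≤ π_{p_c}(n)`) by a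
square root. [folklore] -/
theorem exists_oneArmProb_criticalProbI_sq_lower (hd : 2 ≤ d) :
    ∃ c : ℝ, 0 < c ∧ ∀ n : ℕ, 1 ≤ n → c / (n : ℝ) ^ (d - 1) ≤ oneArmProb d (criticalProbI d) n ^ 2 := by
  have hd1 : 1 ≤ d := by omega
  refine ⟨1 / (2 * d * (2 * d * 3 ^ (d - 1) * 3 ^ (d - 1))), by positivity, fun n hn => ?_⟩
  have h := one_div_le_card_sphere_mul_oneArmProb_sq hd n
  have hcard := card_sphere_succ_le' hd1 (2 * n)
  have hπ0 : 0 ≤ oneArmProb d (criticalProbI d) n ^ 2 := sq_nonneg _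
  have hn1 : (1 : ℝ) ≤ n := by exact_mod_cast hn
  -- `|∂Λ_{2n+1}| ≤ 2d 3^{d-1} (2n+1)^{d-1} ≤ 2d 3^{d-1} 3^{d-1} n^{d-1}`
  have hcard' : (#(sphere d (2 * n + 1)) : ℝ) ≤ 2 * d * 3 ^ (d - 1) * 3 ^ (d - 1) * (n : ℝ) ^ (d - 1) := by
    have h1 : ((2 * n : ℕ) : ℝ) + 1 ≤ 3 * n := by push_cast; linarith
    calc (#(sphere d (2 * n + 1)) : ℝ) ≤ 2 * d * 3 ^ (d - 1) * (((2 * n : ℕ) : ℝ) + 1) ^ (d - 1) := hcard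
      _ ≤ 2 * d * 3 ^ (d - 1) * (3 * (n : ℝ)) ^ (d - 1) := by gcongr
      _ = 2 * d * 3 ^ (d - 1) * 3 ^ (d - 1) * (n : ℝ) ^ (d - 1) := by rw [mul_pow]; ring
  have key : 1 / (2 * d) ≤ 2 * d * 3 ^ (d - 1) * 3 ^ (d - 1) * (n : ℝ) ^ (d - 1) *
      oneArmProb d (criticalProbI d) n ^ 2 :=
    h.trans (mul_le_mul_of_nonneg_right hcard' hπ0)
  have hnd : (0 : ℝ) < (n : ℝ) ^ (d - 1) := by positivity
  have hd0 : (0 : ℝ) < 2 * d := by positivity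
  rw [div_le_iff₀ hd0] at key
  rw [div_le_iff₀ hnd, div_le_iff₀ (by positivity)]
  have heq : oneArmProb d (criticalProbI d) n ^ 2 * (n : ℝ) ^ (d - 1) * (2 * d * (2 * d * 3 ^ (d - 1) * 3 ^ (d - 1))) =
      2 * d * 3 ^ (d - 1) * 3 ^ (d - 1) * (n : ℝ) ^ (d - 1) * oneArmProb d (criticalProbI d) n ^ 2 * (2 * d) := by
    ring
  rw [heq]
  exact key

/-- **THE CRITICAL ONE-ARM PROBABILITY IS AT LEAST `c n^{-(d-1)/2}`**: on `ℤ^d`, `d ≥ 2`, there is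
`c = c(d) > 0` with `c / n^{(d-1)/2} ≤ P_{p_c}(0 ↔ ∂Λ_n)` for all `n ≥ 1` (real exponent; square root of
`exists_oneArmProb_criticalProbI_sq_lower`). On `ℤ²`: `≥ c/√n`; on `ℤ³`: `≥ c/n`; compatible with the mean-field
`n^{-2}` iff `d ≥ 5`. [folklore] -/
theorem exists_oneArmProb_criticalProbI_lower_half (hd : 2 ≤ d) :
    ∃ c : ℝ, 0 < c ∧ ∀ n : ℕ, 1 ≤ n →
      c / (n : ℝ) ^ (((d : ℝ) - 1) / 2) ≤ oneArmProb d (criticalProbI d) n := by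
  obtain ⟨c, hc, h⟩ := exists_oneArmProb_criticalProbI_sq_lower hd
  refine ⟨Real.sqrt c, Real.sqrt_pos.2 hc, fun n hn => ?_⟩
  have hn0 : (0 : ℝ) < n := by exact_mod_cast hn
  have hπ0 : 0 ≤ oneArmProb d (criticalProbI d) n := measureReal_nonneg
  have h1 := h n hn
  -- `(n^{(d-1)/2})² = n^{d-1}`
  have hpow : ((n : ℝ) ^ (((d : ℝ) - 1) / 2)) ^ 2 = (n : ℝ) ^ (d - 1) := by
    rw [← Real.rpow_natCast ((n : ℝ) ^ (((d : ℝ) - 1) / 2)) 2, ← Real.rpow_mul hn0.le]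
    have hd1 : 1 ≤ d := by omega
    rw [show ((d : ℝ) - 1) / 2 * ((2 : ℕ) : ℝ) = ((d - 1 : ℕ) : ℝ) by push_cast [Nat.cast_sub hd1]; try ring,
      Real.rpow_natCast]
  have hq0 : 0 < (n : ℝ) ^ (((d : ℝ) - 1) / 2) := Real.rpow_pos_of_pos hn0 _
  rw [div_le_iff₀ hq0]
  have h2 : c ≤ (oneArmProb d (criticalProbI d) n * (n : ℝ) ^ (((d : ℝ) - 1) / 2)) ^ 2 := by
    rw [mul_pow, hpow]
    rwa [div_le_iff₀ (by positivity)] at h1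
  calc Real.sqrt c ≤ Real.sqrt ((oneArmProb d (criticalProbI d) n * (n : ℝ) ^ (((d : ℝ) - 1) / 2)) ^ 2) :=
        Real.sqrt_le_sqrt h2
    _ = oneArmProb d (criticalProbI d) n * (n : ℝ) ^ (((d : ℝ) - 1) / 2) :=
        Real.sqrt_sq (mul_nonneg hπ0 hq0.le)

/-- The case `d = 3`: `π_{p_c(ℤ³)}(n) ≥ c / n` for all `n ≥ 1`. [folklore] -/
theorem exists_oneArmProb_criticalProbI_three_lower :
    ∃ c : ℝ, 0 < c ∧ ∀ n : ℕ, 1 ≤ n → c / n ≤ oneArmProb 3 (criticalProbI 3) n := by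
  obtain ⟨c, hc, h⟩ := exists_oneArmProb_criticalProbI_lower_half (d := 3) (by norm_num)
  refine ⟨c, hc, fun n hn => ?_⟩
  have h1 := h n hn
  norm_num at h1
  exact h1

end Literature.Probability.Percolation

end
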